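import Summits.BirchSwinnertonDyer.BirchSwinnertonDyer.Theorems.KimAtThreeDeepLowerPortTorsion
import Summits.BirchSwinnertonDyer.BirchSwinnertonDyer.Theorems.KimAtThreeKolyvaginInputs
import HarnessLib

/-!
# Route `KimAtThreeKolyvagin` (rung W2): the UPPER row at every `t`, cruxes `DeepUpperAtThreeOffKatoStratum`
# (19562) / `DeepUpperAtThree` (19076) BY NAME, and the cell's DEEP statement `N11.KimAtThreeDeepPUB`
# (= `DeepLowerAtThree ∧ DeepUpperAtThree`, NO `t`-binder) BY NAME — from PUBLISHED facts + the ONE `t`-indexed port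

Cell `bsd-addord`, seat `bsd-addord-w2-c2` (gen 6; `--supports stmt-BirchSwinnertonDyer-19075`).  Sequel of
`KimAtThreeDeepLowerPortTorsion` (p481375: the LOWER row / cruxes 19679 / 19075 at every `t`).
HONEST FRAMING. TOOL theorems only (no definition, no named fact, no `sorry`); nothing asserted about any curve,
nothing booked, no mark moved; items 19075 / 19076 / 19562 / 19679 and the obligation node `N11.KimAtThreeDeepPUB`
stay OPEN (every theorem concluding one of them does so UNDER HYPOTHESES); BSD is not proved by any of this.
CONDITIONAL on [S24] Thm. 4.4 (1)(2) PINNED (`hS24`/`hS24₂`), GZK, Poitou–Tate, Carayol, and the ONE displayed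
`t`-indexed port text PORT@3-TORS-OFF / PORT@3-TORS-ALL of the prequel (FLAG `K22-Thm3.13-PORT@3`; NOT in print
at `3`; on the `E(ℚ₃)[3] = 0` rows it is w2-c4 g7's PORT@3-OFF / -ALL text, on a `t`-row the value law carries
Kim's `3^t`, AJM 148 Thm. 3.13, guards = the PINNED classes).

WHY / WHAT.  w2-c4 g7's `KimAtThreeShallowEqDeepPortRows.upper_row_of_portUnlocked` feeds acc1's END-OF-PORTS
engine `KimAtThreeDeepUpperOffStratumPortE.deepUpper_conclusion_of_port_e` — PINNED guards, FREE value exponent —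
with the exponent `0` after scaling Kato's families by `3^e`.  The same engine at exponent `t` takes the scaled
witnesses of the `t`-slot-`t` port (`3^e·Λ(κ_d) = u·3^t·δ̃ ⟹ Λ((3^e•κ)_d) = u·3^t·δ̃`, acc6's
`katoKuriharaWitnessAt_smul_of_witnessAtTwoExp`, general `t`), so:
* §1 `portE_tors_of_portUnlocked_tors` — the pinned-guard two-depth port at `(t, e)` gives n1011's single-depth
  one-exponent witnesses `KatoKuriharaWitnessAt W k t Dk v₃ D` at every canonical datum;
* §2 `deepUpper_row_of_portUnlocked_tors` — the UPPER row `∃ d, ∂^{(∞)}_deep = d ∧ ord₃ #Ш(3) + d ≤ ∂⁽⁰⁾` at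
  ANY tower row, ANY `t`;
* §3 **`deepUpperAtThreeOffKatoStratum_of_portTorsOff`** (crux 19562 BY NAME, every row),
  **`deepUpperAtThree_of_pub_of_portTorsAll`** (crux 19076 BY NAME; kim3's optimal-datum reduction, no
  Kato-stratum split, no stub 19561, no PORT″), and **`kimAtThreeDeepPUB_of_pub_of_portTorsAll`**: the cell's
  DEEP statement `N11.KimAtThreeDeepPUB` (Kim's `p = 3` Sha-length formula in the DEEP-limit currency on EVERY
  tower row, `t ≥ 1` included — the statement the `t ≥ 1` rows of 19075 / 19076 exist for) BY NAME from the
  route's four published leaves + PORT@3-TORS-ALL (`KimAtThreeKolyvaginInputs.kimAtThreeDeepPUB_iff_lower_and_upper`).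
NET: with the prequel, BOTH halves of the deep statement at EVERY row rest on {PUB} + the ONE debt class
K22-Thm3.13-PORT@3 (no S24-DEEP, no TamDiv, no (DD), no corner lower halves).  References: [Kim2022StructureSelmer]
Thm. 1.9 (6), Thm. 3.13, Lemma 3.10; [Kim2025RefinedTNC] Thm 1.1/1.2, §5; [Sakamoto2024] Thm. 4.4 (1)(2);
[MazurRubin2004] Thm. 4.4.1, 5.2.12; [MilneADT2006] I Thm. 4.10; [Carayol1986]; [EdixhovenManin1991] Prop. 2.
-/

set_option autoImplicit false
-- the Theorems namespace of a single-conjunct summit repeats the summit name by design (D-0017)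
set_option linter.dupNamespace false

noncomputable section

open scoped Classical NumberField ContRepresentation
open Function Field NumberField IsDedekindDomain IsDedekindDomain.HeightOneSpectrum WeierstrassCurve
  CongruenceSubgroup
  Literature.NumberTheory.EllipticCurves Literature.NumberTheory.EllipticCurves.ModularForms
  Literature.NumberTheory.EllipticCurves.Rank1Residual
  Literature.NumberTheory.GaloisRepresentations
  Literature.NumberTheory.GaloisRepresentations.DiscreteGaloisModule Literature.NumberTheory.GaloisCohomology
  Rat.HeightOneSpectrum
  Summit.BirchSwinnertonDyer.Rank1Residual.GaloisImage
  Summit.BirchSwinnertonDyer.Rank1Residual.GaloisImage.Assembly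
  Summit.BirchSwinnertonDyer.Rank1Residual.X4

namespace Summit.BirchSwinnertonDyer.BirchSwinnertonDyer.Theorems.KimAtThreeDeepLowerPortTorsionUpper

open Summit.BirchSwinnertonDyer.Rank1Residual.Additive
  Summit.BirchSwinnertonDyer.BirchSwinnertonDyer.Theses.KimAtThreeKolyvagin
  Summit.BirchSwinnertonDyer.BirchSwinnertonDyer.Theorems.KimAtThreeKolyvaginDefs
  Summit.BirchSwinnertonDyer.BirchSwinnertonDyer.Theorems.KimAtThreeKolyvaginInputs
  Summit.BirchSwinnertonDyer.BirchSwinnertonDyer.Theorems.KimAtThreeKolyvaginUnitLevelOneRungs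
  Summit.BirchSwinnertonDyer.BirchSwinnertonDyer.Theorems.KimAtThreeDeepLowerKatoStratumOfFacts
  Summit.BirchSwinnertonDyer.BirchSwinnertonDyer.Theorems.KimAtThreeShallowEqDeepSplitGlueNoStub
  Summit.BirchSwinnertonDyer.BirchSwinnertonDyer.Theorems.KimAtThreeKolyvaginIsogenyCruxes
  Summit.BirchSwinnertonDyer.BirchSwinnertonDyer.Theorems.KimAtThreeShallowEqDeepOffStratumAdditiveDefect
  Summit.BirchSwinnertonDyer.BirchSwinnertonDyer.Theorems.KimAtThreeDeepUpperOffStratumPortE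
  Summit.BirchSwinnertonDyer.BirchSwinnertonDyer.Theorems.KimAtThreeDeepLowerOffStratumAdditiveDefectPortTwoExp
  Summit.BirchSwinnertonDyer.BirchSwinnertonDyer.Theorems.KimAtThreeDeepLowerPortTorsion

/-! ### §1 The pinned-guard port at `(t, e)` feeds acc1's single-depth port at exponent `t` -/

/-- **The two-depth port at `t`-slot `t`, exponent `e`, gives n1011's single-depth one-exponent witnesses at
exponent `t`** (`KatoKuriharaWitnessAt W k t Dk v₃ D …` at every canonical `τ`-datum for `η`): the dictionary at
`(k, k)` with the pinned reduction of `exists_torsionReduction_three`, Kato's families scaled by `3^e`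
(acc6's `katoKuriharaWitnessAt_smul_of_witnessAtTwoExp`, general `t`).  `t`-general twin of w2-c4 g7's
`KimAtThreeShallowEqDeepPortRows.portE_of_portUnlocked`. [cite: Kim2022StructureSelmer, Thm. 3.13 (arXiv p. 17)]
[cite: Kato2004Asterisque, Thm. 12.5 (1)] -/
theorem portE_tors_of_portUnlocked_tors
    (W : WeierstrassCurve ℚ) [W.IsElliptic] [W.IsGloballyMinimal]
    {N : ℕ} [NeZero N] (D : ModularParametrizationData W N) (t e : ℕ) (v₃ : HeightOneSpectrum (𝓞 ℚ))
    (η : (q : HeightOneSpectrum (𝓞 ℚ)) → (ZMod (Ideal.absNorm q.asIdeal))ˣ)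
    (hPort : ∀ (k k' : ℕ) (Dk : KolyvaginDatum (W.torsionGaloisModule (((3 : ℕ) : ℤ) ^ k * ((3 : ℕ) : ℤ))))
      (Dk' : KolyvaginDatum (W.torsionGaloisModule (((3 : ℕ) : ℤ) ^ k' * ((3 : ℕ) : ℤ))))
      (red : (W.torsionGaloisModule (((3 : ℕ) : ℤ) ^ k' * ((3 : ℕ) : ℤ))).toContRepresentation →ⁱL
        (W.torsionGaloisModule (((3 : ℕ) : ℤ) ^ k * ((3 : ℕ) : ℤ))).toContRepresentation),
      Dk.IsCanonicalTauDatumThreeAtWith W k k η → Dk'.IsCanonicalTauDatumThreeAtWith W k' k' η → k ≤ k' →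
      (∀ x : geomTorsion W (((3 : ℕ) : ℤ) ^ k' * ((3 : ℕ) : ℤ)),
        ((red x : geomTorsion W (((3 : ℕ) : ℤ) ^ k * ((3 : ℕ) : ℤ))) : geomPoints W) =
          (((3 : ℕ) : ℤ) ^ (k' - k)) • (x : geomPoints W)) →
      ∃ κ Λ κ' κu Λu κu',
        KatoKuriharaWitnessAtTwoExp W k t e Dk v₃ D κ Λ κ' ∧
        KatoKuriharaWitnessAtTwoExp W k' t e Dk' v₃ D κu Λu κu' ∧
        ∀ d, Dk'.IsLevel d → Dk.IsLevel d →
          galoisCohomology.map red 1 (κu d) = κ d ∧ galoisCohomology.map red 1 (κu' d) = κ' d) :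
    ∀ (k : ℕ) (Dk : KolyvaginDatum (W.torsionGaloisModule (((3 : ℕ) : ℤ) ^ k * ((3 : ℕ) : ℤ)))),
      Dk.IsCanonicalTauDatumThreeAtWith W k k η →
      ∃ (κ : Finset (HeightOneSpectrum (𝓞 ℚ)) →
            galoisCohomology (W.torsionGaloisModule (((3 : ℕ) : ℤ) ^ k * ((3 : ℕ) : ℤ))) 1)
        (Λ : galoisCohomology ((W.torsionGaloisModule (((3 : ℕ) : ℤ) ^ k * ((3 : ℕ) : ℤ))).toLocal
            (Sum.inr v₃)) 1 →+ ZMod (3 ^ (k + 1)))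
        (κ' : Finset (HeightOneSpectrum (𝓞 ℚ)) →
            galoisCohomology (W.torsionGaloisModule (((3 : ℕ) : ℤ) ^ k * ((3 : ℕ) : ℤ))) 1),
        KatoKuriharaWitnessAt W k t Dk v₃ D κ Λ κ' := by
  intro k Dk hDk
  obtain ⟨red, hred⟩ := exists_torsionReduction_three W k k
  obtain ⟨κ, Λ, κ', -, -, -, hW, -, -⟩ := hPort k k Dk Dk red hDk hDk le_rfl hred
  exact ⟨_, Λ, _, katoKuriharaWitnessAt_smul_of_witnessAtTwoExp W k t e Dk v₃ D κ Λ κ' hW⟩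

/-! ### §2 The UPPER row at ANY tower row, ANY `t` -/

/-- **UPPER row (cruxes 19076 / 19562) at ANY tower row, ANY local `3`-torsion exponent `t` in the port's
value law: `∃ d, ∂^{(∞)}_deep = d ∧ ord₃ #Ш(3) + d ≤ ∂⁽⁰⁾`** from [S24] (1)(2) PINNED, GZK, Poitou–Tate and the
pinned-guard two-depth port at `(t, e)`: acc1's END-OF-PORTS engine
`KimAtThreeDeepUpperOffStratumPortE.deepUpper_conclusion_of_port_e` at its free exponent `t`, fed by §1;
`L(E,1) ≠ 0` from `ord(δ̃) = 0`.  `t`-general twin of w2-c4 g7's `upper_row_of_portUnlocked`.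
[cite: Kim2025RefinedTNC, Thm 1.1, §5] [cite: Kim2022StructureSelmer, Thm. 1.9 (6) and Thm. 3.13]
[cite: MazurRubin2004, Thm. 4.4.1] [cite: Sakamoto2024, Thm. 4.4 (1)(2) (p. 926)] [cite: MilneADT2006, Ch. I, Thm. 4.10] -/
theorem deepUpper_row_of_portUnlocked_tors
    (hS24 : Sakamoto2024.kolyvaginSystems_freeRankOne_zmod_three_pow)
    (hS24₂ : Sakamoto2024.kolyvaginSystems_idealOfBasis_eq_fittingIdeal_zmod_three_pow)
    (hGZK : rank_eq_analyticRank_of_analyticRank_le_one) (hPT : poitouTate_selmerStructure_duality ℚ)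
    (W : WeierstrassCurve ℚ) [W.IsElliptic] [W.IsGloballyMinimal]
    (htower : ∀ m : ℕ, W.HasSurjectiveModNGaloisRep (3 ^ m : ℕ))
    {N : ℕ} [NeZero N] (D : ModularParametrizationData W N) (t e : ℕ)
    (hint : ∀ r : ℚ, ratPlusSymbol D.f r ≠ 0 → 0 ≤ padicValRat 3 (ratPlusSymbol D.f r))
    (hord : kuriharaVanishingOrder W 3 D.f = 0)
    (v₃ : HeightOneSpectrum (𝓞 ℚ)) (hv₃ : ((3 : ℕ) : 𝓞 ℚ) ∈ v₃.asIdeal)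
    (η : (q : HeightOneSpectrum (𝓞 ℚ)) → (ZMod (Ideal.absNorm q.asIdeal))ˣ)
    (hη : ∀ q : HeightOneSpectrum (𝓞 ℚ), Subgroup.zpowers (η q) = ⊤)
    (hPort : ∀ (k k' : ℕ) (Dk : KolyvaginDatum (W.torsionGaloisModule (((3 : ℕ) : ℤ) ^ k * ((3 : ℕ) : ℤ))))
      (Dk' : KolyvaginDatum (W.torsionGaloisModule (((3 : ℕ) : ℤ) ^ k' * ((3 : ℕ) : ℤ))))
      (red : (W.torsionGaloisModule (((3 : ℕ) : ℤ) ^ k' * ((3 : ℕ) : ℤ))).toContRepresentation →ⁱL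
        (W.torsionGaloisModule (((3 : ℕ) : ℤ) ^ k * ((3 : ℕ) : ℤ))).toContRepresentation),
      Dk.IsCanonicalTauDatumThreeAtWith W k k η → Dk'.IsCanonicalTauDatumThreeAtWith W k' k' η → k ≤ k' →
      (∀ x : geomTorsion W (((3 : ℕ) : ℤ) ^ k' * ((3 : ℕ) : ℤ)),
        ((red x : geomTorsion W (((3 : ℕ) : ℤ) ^ k * ((3 : ℕ) : ℤ))) : geomPoints W) =
          (((3 : ℕ) : ℤ) ^ (k' - k)) • (x : geomPoints W)) →
      ∃ κ Λ κ' κu Λu κu',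
        KatoKuriharaWitnessAtTwoExp W k t e Dk v₃ D κ Λ κ' ∧
        KatoKuriharaWitnessAtTwoExp W k' t e Dk' v₃ D κu Λu κu' ∧
        ∀ d, Dk'.IsLevel d → Dk.IsLevel d →
          galoisCohomology.map red 1 (κu d) = κ d ∧ galoisCohomology.map red 1 (κu' d) = κ' d) :
    ∃ dd : ℕ, kuriharaPartialDeepInfty W 3 D.f = dd ∧
      ((padicValNat 3 (Nat.card (AddCommGroup.primaryComponent W.sha 3)) + dd : ℕ) : ℕ∞) ≤
        kuriharaPartial W 3 D.f 0 := by
  obtain ⟨inv, hperf, hsum, -, hcompl⟩ := hPT 3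
  obtain ⟨inv', hperf', hsum', hcompl', hinj'⟩ := exists_localInvariants_three_pow_of_poitouTate hPT
  exact deepUpper_conclusion_of_port_e hS24 hS24₂ hGZK W htower
    (D.isNewformOf.entireLFunction_one_ne_zero_of_ratPlusSymbol_zero_ne_zero
      (ratPlusSymbol_zero_ne_zero_of_kuriharaVanishingOrder_eq_zero W 3 D.f hord))
    D hint inv hperf hsum hcompl inv' hperf' hsum' hcompl' hinj' v₃ hv₃ η hη t
    (portE_tors_of_portUnlocked_tors W D t e v₃ η hPort)

/-! ### §3 Cruxes 19562 / 19076 and the DEEP statement `N11.KimAtThreeDeepPUB` BY NAME -/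

section PortTorsOff

variable
  (hPortTorsOff : ∀ (W₀ : WeierstrassCurve ℚ) [W₀.IsElliptic] [W₀.IsGloballyMinimal],
    (∀ n : ℕ, W₀.HasSurjectiveModNGaloisRep (3 ^ n : ℕ)) →
    ∀ (t : ℕ), Nat.card {Q : (W₀.baseChange ℚ_[3]).toAffine.Point // (3 : ℕ) • Q = 0} = 3 ^ t →
    ∀ (v₃ : HeightOneSpectrum (𝓞 ℚ)), ((3 : ℕ) : 𝓞 ℚ) ∈ v₃.asIdeal →
    ∀ (η : (q : HeightOneSpectrum (𝓞 ℚ)) → (ZMod (Ideal.absNorm q.asIdeal))ˣ),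
      (∀ q, Subgroup.zpowers (η q) = ⊤) →
    ∀ {N : ℕ} [NeZero N] (P : ModularParametrizationData W₀ N), N = W₀.conductorNorm ℤ →
      (∀ z ∈ P.L.lattice, ∃ w ∈ periodLattice P.f, z = P.c * w) →
      ¬ ((haveI : Fact (Nat.Prime 3) := ⟨Nat.prime_three⟩; Addv W₀ 3) ∧
          ¬ 3 ∣ (W₀.baseChange ℚ_[3]).localTamagawaNumber ℤ_[3] ∧
          Nat.card {Q : (W₀.baseChange ℚ_[3]).toAffine.Point // (3 : ℕ) • Q = 0} = 1 ∧
          ¬ (3 : ℤ) ∣ P.maninConstant) →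
      ∃ e : ℕ, ∀ (k k' : ℕ)
        (Dk : KolyvaginDatum (W₀.torsionGaloisModule (((3 : ℕ) : ℤ) ^ k * ((3 : ℕ) : ℤ))))
        (Dk' : KolyvaginDatum (W₀.torsionGaloisModule (((3 : ℕ) : ℤ) ^ k' * ((3 : ℕ) : ℤ))))
        (red : (W₀.torsionGaloisModule (((3 : ℕ) : ℤ) ^ k' * ((3 : ℕ) : ℤ))).toContRepresentation →ⁱL
          (W₀.torsionGaloisModule (((3 : ℕ) : ℤ) ^ k * ((3 : ℕ) : ℤ))).toContRepresentation),
        Dk.IsCanonicalTauDatumThreeAtWith W₀ k k η → Dk'.IsCanonicalTauDatumThreeAtWith W₀ k' k' η → k ≤ k' →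
        (∀ x : geomTorsion W₀ (((3 : ℕ) : ℤ) ^ k' * ((3 : ℕ) : ℤ)),
          ((red x : geomTorsion W₀ (((3 : ℕ) : ℤ) ^ k * ((3 : ℕ) : ℤ))) : geomPoints W₀) =
            (((3 : ℕ) : ℤ) ^ (k' - k)) • (x : geomPoints W₀)) →
        ∃ κ Λ κ' κu Λu κu',
          KatoKuriharaWitnessAtTwoExp W₀ k t e Dk v₃ P κ Λ κ' ∧
          KatoKuriharaWitnessAtTwoExp W₀ k' t e Dk' v₃ P κu Λu κu' ∧
          ∀ d, Dk'.IsLevel d → Dk.IsLevel d →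
            galoisCohomology.map red 1 (κu d) = κ d ∧ galoisCohomology.map red 1 (κu' d) = κ' d)

include hPortTorsOff

/-- **Crux 19562 `DeepUpperAtThreeOffKatoStratum` BY NAME — EVERY row, the `t ≥ 1` rows included — ⟸ [S24]
(1)(2) PINNED ∧ GZK ∧ Poitou–Tate ∧ PORT@3-TORS-OFF.**  At a row: `#E(ℚ₃)[3] = 3^t`
(`exists_natCard_threeTorsion_eq_three_pow`), `(v₃, η)` (`exists_place_three_and_generators`), the port's `e`,
then §2.  No TamDiv∞, no (DD), no `ht0` / `hbad` certificate, no twin 19679.  `t`-general twin of w2-c4 g7's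
`deepUpperOff_torsionFree_of_portOff`.  CONDITIONAL: does not close the item.
[cite: Kim2025RefinedTNC, Thm 1.1, §5] [cite: Kim2022StructureSelmer, Thm. 1.9 (6), Thm. 3.13]
[cite: Sakamoto2024, Thm. 4.4 (p. 926)] [cite: MazurRubin2004, Thm. 4.4.1] -/
theorem deepUpperAtThreeOffKatoStratum_of_portTorsOff
    (hS24 : Sakamoto2024.kolyvaginSystems_freeRankOne_zmod_three_pow)
    (hS24₂ : Sakamoto2024.kolyvaginSystems_idealOfBasis_eq_fittingIdeal_zmod_three_pow)
    (hGZK : rank_eq_analyticRank_of_analyticRank_le_one) (hPT : poitouTate_selmerStructure_duality ℚ) :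
    DeepUpperAtThreeOffKatoStratum := by
  intro W₀ _ _ htow _ N _ hN D₀ hopt _ hint hord hoff
  obtain ⟨t, ht⟩ := exists_natCard_threeTorsion_eq_three_pow W₀
  obtain ⟨v₃, η, hv₃, hη⟩ := exists_place_three_and_generators
  obtain ⟨e, hPort⟩ := hPortTorsOff W₀ htow t ht v₃ hv₃ η hη D₀ hN hopt hoff
  exact deepUpper_row_of_portUnlocked_tors hS24 hS24₂ hGZK hPT W₀ htow D₀ t e hint hord v₃ hv₃ η hη hPort

end PortTorsOff

section PortTorsAll

variable
  (hPortTorsAll : ∀ (W₀ : WeierstrassCurve ℚ) [W₀.IsElliptic] [W₀.IsGloballyMinimal],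
    (∀ n : ℕ, W₀.HasSurjectiveModNGaloisRep (3 ^ n : ℕ)) →
    ∀ (t : ℕ), Nat.card {Q : (W₀.baseChange ℚ_[3]).toAffine.Point // (3 : ℕ) • Q = 0} = 3 ^ t →
    ∀ (v₃ : HeightOneSpectrum (𝓞 ℚ)), ((3 : ℕ) : 𝓞 ℚ) ∈ v₃.asIdeal →
    ∀ (η : (q : HeightOneSpectrum (𝓞 ℚ)) → (ZMod (Ideal.absNorm q.asIdeal))ˣ),
      (∀ q, Subgroup.zpowers (η q) = ⊤) →
    ∀ {N : ℕ} [NeZero N] (P : ModularParametrizationData W₀ N), N = W₀.conductorNorm ℤ →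
      (∀ z ∈ P.L.lattice, ∃ w ∈ periodLattice P.f, z = P.c * w) →
      ∃ e : ℕ, ∀ (k k' : ℕ)
        (Dk : KolyvaginDatum (W₀.torsionGaloisModule (((3 : ℕ) : ℤ) ^ k * ((3 : ℕ) : ℤ))))
        (Dk' : KolyvaginDatum (W₀.torsionGaloisModule (((3 : ℕ) : ℤ) ^ k' * ((3 : ℕ) : ℤ))))
        (red : (W₀.torsionGaloisModule (((3 : ℕ) : ℤ) ^ k' * ((3 : ℕ) : ℤ))).toContRepresentation →ⁱL
          (W₀.torsionGaloisModule (((3 : ℕ) : ℤ) ^ k * ((3 : ℕ) : ℤ))).toContRepresentation),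
        Dk.IsCanonicalTauDatumThreeAtWith W₀ k k η → Dk'.IsCanonicalTauDatumThreeAtWith W₀ k' k' η → k ≤ k' →
        (∀ x : geomTorsion W₀ (((3 : ℕ) : ℤ) ^ k' * ((3 : ℕ) : ℤ)),
          ((red x : geomTorsion W₀ (((3 : ℕ) : ℤ) ^ k * ((3 : ℕ) : ℤ))) : geomPoints W₀) =
            (((3 : ℕ) : ℤ) ^ (k' - k)) • (x : geomPoints W₀)) →
        ∃ κ Λ κ' κu Λu κu',
          KatoKuriharaWitnessAtTwoExp W₀ k t e Dk v₃ P κ Λ κ' ∧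
          KatoKuriharaWitnessAtTwoExp W₀ k' t e Dk' v₃ P κu Λu κu' ∧
          ∀ d, Dk'.IsLevel d → Dk.IsLevel d →
            galoisCohomology.map red 1 (κu d) = κ d ∧ galoisCohomology.map red 1 (κu' d) = κ' d)

include hPortTorsAll

/-- **Crux 19076 `DeepUpperAtThree` BY NAME ⟸ the route's four published leaves ∧ PORT@3-TORS-ALL** — no
Kato-stratum split, no stub child 19561, no PORT″: kim3 g9's `deepUpperAtThree_of_forall_optimalDatum_atConductor`
(Carayol + isogeny invariance + Edixhoven's optimal datum), then §2 at the row's `t`, `(v₃, η)`, the port's `e`.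
Inputs by the route's names `SakamotoKolyvaginThree` (19558), `RankEqAnalyticRankLeOne` (19921),
`PoitouTateSelmerDuality` (19559), `CarayolLevelEqConductor` (19467).  CONDITIONAL: does not close the item.
[cite: Kim2025RefinedTNC, Thm 1.1, §5] [cite: Kim2022StructureSelmer, Thm. 1.9 (6), Thm. 3.13]
[cite: Sakamoto2024, Thm. 4.4 (p. 926)] [cite: MazurRubin2004, Thm. 4.4.1] [cite: Carayol1986]
[cite: EdixhovenManin1991, Prop. 2] -/
theorem deepUpperAtThree_of_pub_of_portTorsAll (hSak : SakamotoKolyvaginThree) (hGZK : RankEqAnalyticRankLeOne)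
    (hPT : PoitouTateSelmerDuality) (hlev : CarayolLevelEqConductor) : DeepUpperAtThree := by
  refine deepUpperAtThree_of_forall_optimalDatum_atConductor hlev ?_
  intro W₀ _ _ htow _ N _ hN D₀ hopt _ hint hord
  obtain ⟨t, ht⟩ := exists_natCard_threeTorsion_eq_three_pow W₀
  obtain ⟨v₃, η, hv₃, hη⟩ := exists_place_three_and_generators
  obtain ⟨e, hPort⟩ := hPortTorsAll W₀ htow t ht v₃ hv₃ η hη D₀ hN hopt
  exact deepUpper_row_of_portUnlocked_tors hSak.1 hSak.2 hGZK hPT W₀ htow D₀ t e hint hord v₃ hv₃ η hη hPort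

/-- **The cell's DEEP statement `N11.KimAtThreeDeepPUB` BY NAME ⟸ the route's four published leaves ∧
PORT@3-TORS-ALL** — Kim's `p = 3` Sha-length formula in the deep-limit currency, `∂^{(∞)}_deep(δ̃) = d ∈ ℕ` and
`∂⁽⁰⁾(δ̃) = ord₃ #Ш(E)(3) + d`, on EVERY `3`-adic-tower row of analytic rank `0` (NO `E(ℚ₃)[3]` binder; the
statement the `t ≥ 1` rows of 19075 / 19076 serve): `kimAtThreeDeepPUB_iff_lower_and_upper` on the prequel's
`deepLowerAtThree_of_pub_of_portTorsAll` and `deepUpperAtThree_of_pub_of_portTorsAll`.  CONDITIONAL (the port is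
a displayed hypothesis, FLAG `K22-Thm3.13-PORT@3`): does not discharge the obligation node; nothing booked.
[cite: Kim2025RefinedTNC, Thm 1.1] [cite: Kim2022StructureSelmer, Thm. 1.9 (6), Thm. 3.13]
[cite: Sakamoto2024, Thm. 4.4 (p. 926)] [cite: MazurRubin2004, Thm. 4.4.1 and Thm. 5.2.12] [cite: Carayol1986] -/
theorem kimAtThreeDeepPUB_of_pub_of_portTorsAll (hSak : SakamotoKolyvaginThree) (hGZK : RankEqAnalyticRankLeOne)
    (hPT : PoitouTateSelmerDuality) (hlev : CarayolLevelEqConductor) : N11.KimAtThreeDeepPUB :=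
  kimAtThreeDeepPUB_iff_lower_and_upper.mpr
    ⟨KimAtThreeDeepLowerPortTorsion.deepLowerAtThree_of_pub_of_portTorsAll hPortTorsAll hSak hGZK hPT hlev,
      deepUpperAtThree_of_pub_of_portTorsAll hPortTorsAll hSak hGZK hPT hlev⟩

end PortTorsAll

end Summit.BirchSwinnertonDyer.BirchSwinnertonDyer.Theorems.KimAtThreeDeepLowerPortTorsionUpper

end

/-! ## ERRATUM (w2-c2 gen 6, 2026-08-27T02:45Z, append-only; no declaration changed)

The module docstring's sentence «the faithful `p = 3` port on a `t`-row is w2-c4's unlocked text with the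
`t`-slot `t` (guards `k k` / `k′ k′`: PINNED classes)» and the reading «n1011's (B6) guards `k + t` / acc1's depth
shift 2 are DISCHARGER conveniences, not part of the printed law» are WITHDRAWN.  [MR04] App. A, Prop. A.2
(pp. 79–80): when `H⁰(ℚ_p, T*)` is not divisible — for `T₃E`: `E(ℚ₃)[3] ≠ 0`, i.e. `t ≥ 1` — the derivative
classes `κ_n^{(k)}` satisfy the CANONICAL local condition at `p` only for `n ∈ 𝒩_j` with `j` beyond the stable
range («`𝓕(ℚ_p, T/m^k)` is the image of `H¹(ℚ_p, T/m^j)` for `j ≫ 0`; for `n ∈ 𝒩_j`, `I_n ⊂ m^j`»); the tree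
has it with the level explicit (n1011 T-DER-BP, `PropagatedConditionStableRangeThree`:
`im red_N = 𝓕_can(E[3^{k+1}])₃` iff `N ≥ N₀`, the torsion-stable level of `E(ℚ₃)`), and Kim AJM 148 Thm. 3.13 is
stated on `Sel_{rel,n}` (relaxed at `p`, extended `exp*` of §3.3.2) for the same reason.  So at `t ≥ 1` clause (0)
of `KatoKuriharaWitnessAt[TwoExp]` (Selmer membership for `𝓕_can` PROPAGATED at `3`) is supported by print ONLY
on data whose primes lie in the class of depth `k + N₀` — the DEEP guards of n1011's PORT″ / acc6's PORT₂ — and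
the pinned-guard `t`-slot-`t` port hypothesis of this file (`hPort` of §1–§2 at `t ≥ 1`, `hPortTorsOff` /
`hPortTorsAll` at `t ≥ 1`) OVER-ASKS: it is not known to follow from Kato's Euler system, may fail on rows where
some pinned level's class does not lift at `3`, and must NOT be registered as an item text.  Every theorem here
remains a valid kernel statement; at `t = 0` (`#E(ℚ₃)[3] = 1`, `N₀ = 0`) the hypothesis IS w2-c4 g7's PORT@3-OFF
/ -ALL and nothing changes.  The `t ≥ 1` rows' road of record stays acc3's (R₁)
(`KimAtThreeDeepLowerOffStratumAdditiveDefectTorsionSplit.torsionRows_of_deepPortsTwoExp`: deep-guard PORT₂ +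
S24-DEEP (1)(2)) until the flag-free deep END (`KimAtThreeDeepLowerS24DeepOfPinned` re-key + one port-free good
core vertex per class depth) lands.  [cite: MazurRubin2004, App. A, Lemma A.1 and Prop. A.2 (pp. 79–80)]
[cite: Kim2022StructureSelmer, §3.3.2 and Thm. 3.13 (arXiv p. 17)] -/
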